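import Summits.AtomisticToContinuum.Crystallization.Theorems.FrustratedLawDichotomyCellChecker

/-!
# FrustratedLawDichotomy · crux `AperiodicFrustratedLawGap` (stmt-AtomisticToContinuum-27623) — CELL CERTIFICATE CHECKER, SOUNDNESS
# (decomp-a2c, prover hand 1, generation 15; critic row 564 (i))

`geom_sound` (`0 < DEN`, `1 ≤ N₀`, `PerSep`, dual basis, `‖b_j‖ ≤ cB`, `DiamLE`, `cB(9/2 + Dq) < k₀ + 1` from `checkGeom`), `class_sound` (the flags
`GoodAtScale (1/8) 2` / `¬ MaybeGoodAt (1/20) 2` and the site-sum bound of a class from `checkClass`), and ★ `not_schurElasticPricing_fourHalf_of_check`: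
an accepted certificate with `Σ_m ((Ub_m + 3/200)/2 − 3/400) < N₀·(eUp + κ_E)` refutes `SchurElasticPricing (1/20) (1/8) w₄₅ ω₄ (3/400) eUp κ_E C_E D_E`
for all `C_E, D_E` (via `…PeriodicBlockViolation.not_schurElasticPricing_of_cell`).  All `[folklore]`; 0 sorry.
-/
noncomputable section

namespace Summit.AtomisticToContinuum.Crystallization.Theorems.FrustratedLawDichotomyCellChecker

open scoped BigOperators RealInnerProductSpace
open Literature.Geometry.DiscreteGeometry (intVec sqNormInt norm_intVec intVec_sub intVec_apply intVec_add intVec_zsmul inner_intVec dotInt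
  hcpKissingPattern hcpTab hcpTab_injective scaledPattern_map_injective sqNormInt_hcpInt hcpInt_eq_image norm_eq_one_of_mem_hcpKissingPattern)
open Literature.MathematicalPhysics.StatisticalMechanics (lennardJones)
open Summit.AtomisticToContinuum.Crystallization.Theorems.ChargedEnergyGapNegative (E3)
open Summit.AtomisticToContinuum.Crystallization.Theorems.FrustratedLawDichotomyRangeCut (GoodAt Sep)
open Summit.AtomisticToContinuum.Crystallization.Theorems.FrustratedLawDichotomyMotifLemmas (GoodAtScale)
open Summit.AtomisticToContinuum.Crystallization.Theorems.FrustratedLawDichotomyMotifDoorE (MaybeGoodAt)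
open Summit.AtomisticToContinuum.Crystallization.Theorems.FrustratedLawDichotomySchurCut
open Summit.AtomisticToContinuum.Crystallization.Theorems.FrustratedLawDichotomyPeriodicBlockGeometry (latVec abs_coord_le_of_dual' latVec_zero)
open Summit.AtomisticToContinuum.Crystallization.Theorems.FrustratedLawDichotomyPeriodicBlockKernel (superMotif PerSep DiamLE)
open Summit.AtomisticToContinuum.Crystallization.Theorems.FrustratedLawDichotomyPeriodicBlockViolation (not_schurElasticPricing_of_cell)
open Summit.AtomisticToContinuum.Crystallization.Theorems.FrustratedLawDichotomyCellKitW
open Summit.AtomisticToContinuum.Crystallization.Theorems.FrustratedLawDichotomyCellKitF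

namespace Cell

variable (c : Cell)

/-! ## §1. The supercell motif and its distances -/

/-- The supercell motif of the cell under the enumeration of part F. -/
abbrev zM : Fin (c.N₀ * c.K3) → E3 := superMotif c.x c.a (cellμ c.N₀ c.k₀) (cellσ c.N₀ c.k₀)

/-- The supercell point with pair label `(m', t)`. [folklore] -/
theorem zM_pair (m' : Fin c.N₀) (t : Fin c.K3) : c.zM (finProdFinEquiv (m', t)) = qpt c.DEN (c.ptN m' t) := by
  show superMotif c.x c.a (cellμ c.N₀ c.k₀) (cellσ c.N₀ c.k₀) (finProdFinEquiv (m', t)) = _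
  rw [superMotif_eq, ptZ_eq_ptN]
  simp [cellμ]

/-- The class centre. [folklore] -/
theorem zM_cellIdx (m : Fin c.N₀) : c.zM (cellIdx c.N₀ c.k₀ m) = qpt c.DEN (c.X m) := c.superMotif_cellIdx m

/-- `nN ≥ 0`. [folklore] -/
theorem nN_nonneg (m m' : Fin c.N₀) (t : ℕ) : 0 ≤ c.nN m m' t := by unfold nN sqNormInt; positivity

/-- Distance of a supercell point to the class centre. [folklore] -/
theorem dist_zM (hD : 0 < c.DEN) (m : Fin c.N₀) (q : Fin (c.N₀ * c.K3)) :
    dist (c.zM q) (c.zM (cellIdx c.N₀ c.k₀ m)) = ((c.DEN : ℝ))⁻¹ * Real.sqrt (c.nN m (cellμ c.N₀ c.k₀ q) (finProdFinEquiv.symm q).2 : ℝ) := by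
  rw [zM_cellIdx]; exact c.dist_superMotif_centre hD m q

/-- Distance of the pair-labelled point to the class centre. [folklore] -/
theorem dist_zM_pair (hD : 0 < c.DEN) (m m' : Fin c.N₀) (t : Fin c.K3) :
    dist (c.zM (finProdFinEquiv (m', t))) (c.zM (cellIdx c.N₀ c.k₀ m)) = ((c.DEN : ℝ))⁻¹ * Real.sqrt (c.nN m m' t : ℝ) := by
  rw [dist_zM c hD]; simp [cellμ]

/-- A point at numerator distance `0` IS the centre. [folklore] -/
theorem nN_ne_zero_of_ne (hD : 0 < c.DEN) {m : Fin c.N₀} {q : Fin (c.N₀ * c.K3)}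
    (hne : c.zM q ≠ c.zM (cellIdx c.N₀ c.k₀ m)) : c.nN m (cellμ c.N₀ c.k₀ q) (finProdFinEquiv.symm q).2 ≠ 0 := by
  intro h0
  apply hne
  rw [← dist_eq_zero, dist_zM c hD, h0]
  simp

/-- `DEN⁻¹·√Q ≤ DEN⁻¹·√n` from `Q ≤ n`. [folklore] -/
theorem scaled_sqrt_mono (hD : 0 < c.DEN) {Q n : ℤ} (h : Q ≤ n) :
    ((c.DEN : ℝ))⁻¹ * Real.sqrt (Q : ℝ) ≤ ((c.DEN : ℝ))⁻¹ * Real.sqrt (n : ℝ) :=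
  mul_le_mul_of_nonneg_left (Real.sqrt_le_sqrt (by exact_mod_cast h)) (by positivity)

/-! ## §2. Geometry -/

/-- Every `s` with `|s|_∞ ≤ S` occurs in `cubeList S`. [folklore] -/
theorem mem_cubeList {S : ℕ} {s : Fin 3 → ℤ} (hs : ∀ k, |s k| ≤ S) : s ∈ cubeList S := by
  obtain ⟨q, -, hq⟩ := cell_sup 1 S 0 s hs
  set t := (finProdFinEquiv.symm q).2 with ht
  rw [cubeList, List.mem_map]
  refine ⟨t, List.mem_range.2 t.2, ?_⟩
  rw [← hq, cellσ_eq]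
  funext k
  exact (cellDigits_val S t k).symm

/-- ★ **Geometry soundness.** [folklore] -/
theorem geom_sound (h : c.checkGeom = true) :
    0 < c.DEN ∧ 1 ≤ c.N₀ ∧ PerSep c.x c.a ∧ (∀ j k, ⟪c.b j, c.a k⟫ = if j = k then (1 : ℝ) else 0) ∧ (∀ j, ‖c.b j‖ ≤ c.cB) ∧
      DiamLE c.x c.Dq ∧ (c.cB : ℝ) * (9 / 2 + c.Dq) < (c.k₀ : ℝ) + 1 := by
  simp only [checkGeom, Bool.and_eq_true, decide_eq_true_eq] at h
  obtain ⟨⟨⟨⟨⟨⟨⟨⟨⟨hD, hN⟩, hcB⟩, hDq⟩, hdual⟩, hb⟩, hdiam⟩, hk⟩, hfar⟩, hsep⟩ := h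
  have hD' : (0 : ℝ) < c.DEN := by exact_mod_cast hD
  have hdualR : ∀ j k, ⟪c.b j, c.a k⟫ = if j = k then (1 : ℝ) else 0 := by
    intro j k
    have hq := hdual j k
    have hq' : (c.bs : ℝ) * (dotInt (c.Bz j) (c.A k) : ℝ) = if j = k then (c.DEN : ℝ) else 0 := by split_ifs at hq ⊢ <;> exact_mod_cast hq
    rw [Cell.b, Cell.a, qpt, real_inner_smul_left, real_inner_smul_right, inner_intVec]
    split_ifs at hq' ⊢ with hjk
    · rw [← mul_assoc, mul_right_comm, hq']; field_simp
    · rw [← mul_assoc, mul_right_comm, hq', zero_mul]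
  have hbR : ∀ j, ‖c.b j‖ ≤ c.cB := by
    intro j
    have hcB' : (0 : ℝ) ≤ c.cB := by exact_mod_cast hcB.le
    have h0 : (0 : ℝ) ≤ (sqNormInt (c.Bz j) : ℝ) := by exact_mod_cast (show (0 : ℤ) ≤ sqNormInt (c.Bz j) by unfold sqNormInt; positivity)
    have hsq : ‖c.b j‖ ^ 2 ≤ (c.cB : ℝ) ^ 2 := by
      rw [Cell.b, norm_smul, mul_pow, norm_intVec, Real.sq_sqrt h0, Real.norm_eq_abs, sq_abs]
      exact_mod_cast hb j
    exact (pow_le_pow_iff_left₀ (norm_nonneg _) hcB' two_ne_zero).1 hsq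
  have hdiamR : DiamLE c.x c.Dq := by
    intro m m'
    have hDq' : (0 : ℝ) ≤ c.Dq := by exact_mod_cast hDq
    have hsq : ‖c.x m - c.x m'‖ ^ 2 ≤ (c.Dq : ℝ) ^ 2 := by
      change ‖qpt c.DEN (c.X m) - qpt c.DEN (c.X m')‖ ^ 2 ≤ _
      rw [← dist_eq_norm, dist_qpt_sq hD, div_le_iff₀ (pow_pos hD' 2)]
      exact_mod_cast hdiam m m'
    exact (pow_le_pow_iff_left₀ (norm_nonneg _) hDq' two_ne_zero).1 hsq
  have hkR : (c.cB : ℝ) * (9 / 2 + c.Dq) < c.k₀ + 1 := by have h := (Rat.cast_lt (K := ℝ)).2 hk; push_cast at h; exact h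
  refine ⟨hD, hN, ?_, hdualR, hbR, hdiamR, hkR⟩
  -- periodic separation
  intro m m' s hms
  have hrepr : dist (c.x m) (c.x m' + latVec c.a s) = ((c.DEN : ℝ))⁻¹ * Real.sqrt (sqNormInt (c.X m - c.X m' - latZ c.A s) : ℝ) := by
    show dist (qpt c.DEN (c.X m)) (qpt c.DEN (c.X m') + latVec (fun k => qpt c.DEN (c.A k)) s) = _
    rw [latVec_qpt, qpt_add, dist_qpt hD, sub_add_eq_sub_sub]
  by_cases hsmall : ∀ k, |s k| ≤ c.S₀
  · rcases hsep m m' s (mem_cubeList hsmall) with ⟨rfl, rfl⟩ | hle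
    · exact absurd hms (by simp)
    · have hsq : ((7 : ℝ) / 10) ^ 2 ≤ dist (c.x m) (c.x m' + latVec c.a s) ^ 2 := by
        rw [hrepr, mul_pow, Real.sq_sqrt (by exact_mod_cast (show (0:ℤ) ≤ sqNormInt _ by unfold sqNormInt; positivity)), inv_pow,
          ← div_eq_inv_mul, le_div_iff₀ (pow_pos hD' 2)]
        have : (49 : ℝ) * (c.DEN : ℝ) ^ 2 ≤ 100 * (sqNormInt (c.X m - c.X m' - latZ c.A s) : ℝ) := by exact_mod_cast hle
        linarith
      exact (pow_le_pow_iff_left₀ (by norm_num) dist_nonneg two_ne_zero).1 hsq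
  · push Not at hsmall
    obtain ⟨k, hk'⟩ := hsmall
    have hcBR : (0 : ℝ) < c.cB := by exact_mod_cast hcB
    have hcoord := abs_coord_le_of_dual' hdualR hbR s k
    have hsk : (c.S₀ : ℝ) + 1 ≤ |((s k : ℤ) : ℝ)| := by rw [← Int.cast_abs]; exact_mod_cast hk'
    have hL : ((c.S₀ : ℝ) + 1) / c.cB ≤ ‖latVec c.a s‖ := by rw [div_le_iff₀ hcBR]; linarith [hcoord]
    have hfarR : (c.cB : ℝ) * (c.Dq + 7 / 10) ≤ c.S₀ + 1 := by have h := (Rat.cast_le (K := ℝ)).2 hfar; push_cast at h; exact h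
    have hDq7 : (c.Dq : ℝ) + 7 / 10 ≤ ((c.S₀ : ℝ) + 1) / c.cB := by rw [le_div_iff₀ hcBR]; linarith
    have hxm := hdiamR m m'
    calc (7 : ℝ) / 10 ≤ ‖latVec c.a s‖ - ‖c.x m - c.x m'‖ := by linarith
      _ ≤ ‖(c.x m - c.x m') - latVec c.a s‖ := by
          have := norm_sub_norm_le (latVec c.a s) (c.x m - c.x m')
          rw [← norm_neg ((c.x m - c.x m') - latVec c.a s)]
          have hneg : -((c.x m - c.x m') - latVec c.a s) = latVec c.a s - (c.x m - c.x m') := by abel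
          rw [hneg]; linarith [this]
      _ = dist (c.x m) (c.x m' + latVec c.a s) := by rw [dist_eq_norm, sub_add_eq_sub_sub]

/-! ## §3. Classes -/

/-- The isometry `±id`. -/
def signIso (e : Bool) : E3 →ₗᵢ[ℝ] E3 := if e then LinearIsometry.id else (LinearIsometryEquiv.neg ℝ).toLinearIsometry

/-- `signIso e` acts as `±1 •`. [folklore] -/
theorem signIso_apply (e : Bool) (u : E3) : signIso e u = ((if e then (1 : ℤ) else -1 : ℤ) : ℝ) • u := by
  unfold signIso
  cases e <;> simp

/-- Index of an hcp pattern point in `hcpTab`. -/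
def hidx (u : ↥hcpKissingPattern) : Fin 12 := Classical.choose (hcpPattern_exists_tab u)

/-- The chosen index enumerates the point. [folklore] -/
theorem hidx_spec (u : ↥hcpKissingPattern) : (u : E3) = (Real.sqrt 18)⁻¹ • intVec (hcpTab (hidx u)) :=
  Classical.choose_spec (hcpPattern_exists_tab u)

/-- The pattern point of `hcpTab i`. -/
def hpt (i : Fin 12) : ↥hcpKissingPattern :=
  ⟨(Real.sqrt 18)⁻¹ • intVec (hcpTab i), by
    rw [show hcpKissingPattern = Literature.Geometry.DiscreteGeometry.scaledPattern Literature.Geometry.DiscreteGeometry.hcpInt 18 from rfl,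
      Literature.Geometry.DiscreteGeometry.scaledPattern, hcpInt_eq_image, Finset.image_image]
    exact Finset.mem_image.2 ⟨i, Finset.mem_univ _, rfl⟩⟩

/-- `hidx` inverts `hpt`. [folklore] -/
theorem hidx_hpt (i : Fin 12) : hidx (hpt i) = i := by
  have h := hidx_spec (hpt i)
  simp only [hpt] at h
  exact (hcpTab_injective (scaledPattern_map_injective (N := 18) (by norm_num) h)).symm

/-- The scan fact of a point, unpacked. [folklore] -/
theorem scan_point {m : Fin c.N₀} {C : ClassCert c.N₀ c.K3}
    (hscan : ∀ m' : Fin c.N₀, allBelow (fun t =>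
      scanPt C.Qn (c.thrOut C) (c.thrIn C) (decide (∃ i : Fin 12, (C.asg i).1 = m' ∧ ((C.asg i).2 : ℕ) = t)) (c.nN m m' t)) c.K3 = true)
    (m' : Fin c.N₀) (t : Fin c.K3) :
    c.nN m m' t = 0 ∨ ((C.Qn : ℤ) ≤ c.nN m m' t ∧ (c.thrOut C ≤ c.nN m m' t ∨
      (c.nN m m' t ≤ c.thrIn C ∧ ∃ i : Fin 12, C.asg i = (m', t)))) := by
  have h := allBelow_spec (hscan m') t t.2
  simp only [scanPt, Bool.or_eq_true, Bool.and_eq_true, decide_eq_true_eq] at h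
  rcases h with h | ⟨h1, h2 | ⟨h3, i, hi1, hi2⟩⟩
  · exact Or.inl h
  · exact Or.inr ⟨h1, Or.inl h2⟩
  · exact Or.inr ⟨h1, Or.inr ⟨h3, i, Prod.ext hi1 (Fin.ext hi2)⟩⟩

/-- ★ **Class soundness**: the two flags and the site-sum bound. [folklore] -/
theorem class_sound (hD : 0 < c.DEN) (m : Fin c.N₀) (C : ClassCert c.N₀ c.K3) (h : c.checkClass m C = true) :
    GoodAtScale (1 / 8) 2 c.zM (cellIdx c.N₀ c.k₀ m) ∧ ¬ MaybeGoodAt (1 / 20) 2 c.zM (cellIdx c.N₀ c.k₀ m) ∧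
      (∑ q, effPot w₄₅ ω₄ (3 / 400) (dist (c.x m) (c.zM q))) ≤ (C.Ub : ℝ) := by
  simp only [checkClass, Bool.and_eq_true, decide_eq_true_eq] at h
  obtain ⟨⟨⟨⟨⟨⟨⟨⟨hQ0, hnn⟩, hQ4⟩, hfar⟩, hs⟩, hthr⟩, hfit⟩, hscan⟩, hsum⟩ := h
  have hD' : (0 : ℝ) < c.DEN := by exact_mod_cast hD
  set d₀ : ℝ := ((c.DEN : ℝ))⁻¹ * Real.sqrt (C.Qn : ℝ) with hd₀
  have hQ0R : (0 : ℝ) < C.Qn := by exact_mod_cast hQ0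
  have hsQ : 0 < Real.sqrt (C.Qn : ℝ) := Real.sqrt_pos.2 hQ0R
  have hd₀pos : 0 < d₀ := mul_pos (inv_pos.2 hD') hsQ
  -- pinning
  have hpin : ∀ a, c.zM a ≠ c.zM (cellIdx c.N₀ c.k₀ m) → d₀ ≤ dist (c.zM a) (c.zM (cellIdx c.N₀ c.k₀ m)) := by
    intro a ha
    have hn0 := c.nN_ne_zero_of_ne hD ha
    rcases c.scan_point hscan (cellμ c.N₀ c.k₀ a) (finProdFinEquiv.symm a).2 with h0 | ⟨hQn, -⟩
    · exact absurd h0 hn0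
    · rw [c.dist_zM hD]
      have := c.scaled_sqrt_mono hD hQn
      simpa using this
  -- the nearest neighbour
  set qnn := finProdFinEquiv C.nn with hqnn
  have hdnn : dist (c.zM qnn) (c.zM (cellIdx c.N₀ c.k₀ m)) = d₀ := by
    rw [hqnn, show C.nn = (C.nn.1, C.nn.2) from rfl, c.dist_zM_pair hD, hnn]; simp [hd₀]
  have hnn_ne : c.zM qnn ≠ c.zM (cellIdx c.N₀ c.k₀ m) := fun h => hd₀pos.ne' (by rw [← hdnn]; exact dist_eq_zero.2 h)
  have hnnW : ∃ a, c.zM a ≠ c.zM (cellIdx c.N₀ c.k₀ m) ∧ dist (c.zM a) (c.zM (cellIdx c.N₀ c.k₀ m)) ≤ d₀ := ⟨qnn, hnn_ne, hdnn.le⟩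
  -- enclosure of `d₀`
  have hlo : (c.loOf C : ℝ) ≤ d₀ := by
    have h1 : ((C.s : ℝ)) ^ 2 ≤ (C.Qn : ℝ) * (sqrtPrec : ℝ) ^ 2 := by exact_mod_cast hs.1
    have hP : (0 : ℝ) < sqrtPrec := by unfold sqrtPrec; norm_num
    have hlo' : (c.loOf C : ℝ) = (C.s : ℝ) / (c.DEN * sqrtPrec) := by simp [loOf]
    rw [hlo', hd₀, div_le_iff₀ (by positivity)]
    have hsle : (C.s : ℝ) ≤ Real.sqrt (C.Qn : ℝ) * sqrtPrec := by
      have : (C.s : ℝ) ^ 2 ≤ (Real.sqrt (C.Qn : ℝ) * sqrtPrec) ^ 2 := by rw [mul_pow, Real.sq_sqrt hQ0R.le]; exact h1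
      exact (pow_le_pow_iff_left₀ (by positivity) (by positivity) two_ne_zero).1 this
    calc (C.s : ℝ) ≤ Real.sqrt (C.Qn : ℝ) * sqrtPrec := hsle
      _ = ((c.DEN : ℝ))⁻¹ * Real.sqrt (C.Qn : ℝ) * (c.DEN * sqrtPrec) := by field_simp
  have hhi : d₀ ≤ (c.hiOf C : ℝ) := by
    have h2 : (C.Qn : ℝ) * (sqrtPrec : ℝ) ^ 2 ≤ ((C.s : ℝ) + 1) ^ 2 := by exact_mod_cast hs.2.le
    have hP : (0 : ℝ) < sqrtPrec := by unfold sqrtPrec; norm_num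
    have hhi' : (c.hiOf C : ℝ) = ((C.s : ℝ) + 1) / (c.DEN * sqrtPrec) := by simp [hiOf]
    rw [hhi', hd₀, le_div_iff₀ (by positivity)]
    have hsle : Real.sqrt (C.Qn : ℝ) * sqrtPrec ≤ (C.s : ℝ) + 1 := by
      have : (Real.sqrt (C.Qn : ℝ) * sqrtPrec) ^ 2 ≤ ((C.s : ℝ) + 1) ^ 2 := by rw [mul_pow, Real.sq_sqrt hQ0R.le]; exact h2
      exact (pow_le_pow_iff_left₀ (by positivity) (by positivity) two_ne_zero).1 this
    calc ((c.DEN : ℝ))⁻¹ * Real.sqrt (C.Qn : ℝ) * (c.DEN * sqrtPrec) = Real.sqrt (C.Qn : ℝ) * sqrtPrec := by field_simp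
      _ ≤ (C.s : ℝ) + 1 := hsle
  refine ⟨?_, ?_, ?_⟩
  · -- ★ goodness: the explicit hcp fit with `A = ±id`
    refine goodAtScale_hcp_of_fit (d₀ := d₀) (η := (etaFit : ℝ)) (γ := (gam : ℝ)) (signIso C.eps)
      (fun u => finProdFinEquiv (C.asg (hidx u))) hd₀pos ?_ (by norm_num [gam]) (by norm_num [etaFit]) ?_ hpin hnnW ?_
    · -- `d₀ ≤ 2`
      rw [hd₀, inv_mul_le_iff₀ hD']
      have : Real.sqrt (C.Qn : ℝ) ≤ Real.sqrt ((2 * c.DEN : ℝ) ^ 2) := Real.sqrt_le_sqrt (by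
        have : (C.Qn : ℝ) ≤ 4 * (c.DEN : ℝ) ^ 2 := by exact_mod_cast hQ4
        linarith)
      rw [Real.sqrt_sq (by positivity)] at this
      linarith
    · -- the fit of the twelve assigned points
      intro u
      set i := hidx u with hi
      obtain ⟨hG, hcert⟩ := hfit i
      rw [show C.asg i = ((C.asg i).1, (C.asg i).2) from rfl, zM_pair, zM_cellIdx, qpt_sub, hidx_spec u, ← hi, signIso_apply,
        qpt, hd₀]
      have hε : (((if C.eps then (1 : ℤ) else -1 : ℤ)) : ℝ) = 1 ∨ (((if C.eps then (1 : ℤ) else -1 : ℤ)) : ℝ) = -1 := by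
        cases C.eps <;> simp
      have key := norm_sub_smul_le_of_cert (V := c.ptN (C.asg i).1 (C.asg i).2 - c.X m) (h := hcpTab i) (N := 18) (by norm_num)
        ((by decide : ∀ i : Fin 12, sqNormInt (hcpTab i) = (18 : ℕ)) i) (Qn := C.Qn) hε (η := etaFit) (by norm_num [etaFit])
        (by norm_num [etaFit]) (G := c.sgnOf C * dotInt (c.ptN (C.asg i).1 (C.asg i).2 - c.X m) (hcpTab i))
        (by simp only [sgnOf]; push_cast; ring) hG hcert
      have hfac : ((c.DEN : ℝ))⁻¹ • intVec (c.ptN (C.asg i).1 (C.asg i).2 - c.X m) -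
          (((c.DEN : ℝ))⁻¹ * Real.sqrt (C.Qn : ℝ)) • ((((if C.eps then (1 : ℤ) else -1 : ℤ)) : ℝ) • ((Real.sqrt 18)⁻¹ • intVec (hcpTab i))) =
          ((c.DEN : ℝ))⁻¹ • (intVec (c.ptN (C.asg i).1 (C.asg i).2 - c.X m) -
            Real.sqrt (C.Qn : ℝ) • ((((if C.eps then (1 : ℤ) else -1 : ℤ)) : ℝ) • ((Real.sqrt (18 : ℕ))⁻¹ • intVec (hcpTab i)))) := by
        push_cast
        rw [smul_sub]
        simp only [smul_smul, mul_assoc]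
      rw [hfac, norm_smul, norm_inv, Real.norm_of_nonneg hD'.le]
      calc ((c.DEN : ℝ))⁻¹ * ‖intVec (c.ptN (C.asg i).1 (C.asg i).2 - c.X m) -
              Real.sqrt (C.Qn : ℝ) • ((((if C.eps then (1 : ℤ) else -1 : ℤ)) : ℝ) • ((Real.sqrt (18 : ℕ))⁻¹ • intVec (hcpTab i)))‖
          ≤ ((c.DEN : ℝ))⁻¹ * ((etaFit : ℝ) * Real.sqrt (C.Qn : ℝ)) := mul_le_mul_of_nonneg_left key (by positivity)
        _ = (etaFit : ℝ) * (((c.DEN : ℝ))⁻¹ * Real.sqrt (C.Qn : ℝ)) := by ring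
    · -- the clean shell
      intro a ha hlt
      have hn0 := c.nN_ne_zero_of_ne hD ha
      rcases c.scan_point hscan (cellμ c.N₀ c.k₀ a) (finProdFinEquiv.symm a).2 with h0 | ⟨-, hout | ⟨hin, i, hi⟩⟩
      · exact absurd h0 hn0
      · -- beyond the gap: contradiction with `dist < 13/10 d₀ + γ`
        exfalso
        have hge : ((13 / 10 * c.hiOf C + gam) ^ 2 * (c.DEN : ℚ) ^ 2 : ℚ) ≤ (c.nN m (cellμ c.N₀ c.k₀ a) (finProdFinEquiv.symm a).2 : ℚ) := by
          unfold thrOut at hout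
          exact (Int.le_ceil _).trans (Int.cast_le.2 hout)
        have hgeR : ((13 : ℝ) / 10 * (c.hiOf C : ℝ) + (gam : ℝ)) ^ 2 * (c.DEN : ℝ) ^ 2 ≤ (c.nN m (cellμ c.N₀ c.k₀ a) (finProdFinEquiv.symm a).2 : ℝ) := by
          have h := (Rat.cast_le (K := ℝ)).2 hge; push_cast at h; exact h
        have hdist : dist (c.zM a) (c.zM (cellIdx c.N₀ c.k₀ m)) ^ 2 = (c.nN m (cellμ c.N₀ c.k₀ a) (finProdFinEquiv.symm a).2 : ℝ) / (c.DEN : ℝ) ^ 2 := by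
          rw [c.dist_zM hD, mul_pow, inv_pow, Real.sq_sqrt (by exact_mod_cast c.nN_nonneg _ _ _)]; field_simp
        have hgam : (0 : ℝ) < gam := by norm_num [gam]
        have h1 : (13 : ℝ) / 10 * d₀ + gam ≤ 13 / 10 * c.hiOf C + gam := by linarith
        have h2 : (13 / 10 * c.hiOf C + (gam : ℝ)) ^ 2 ≤ dist (c.zM a) (c.zM (cellIdx c.N₀ c.k₀ m)) ^ 2 := by
          rw [hdist, le_div_iff₀ (pow_pos hD' 2)]; exact hgeR
        have h3 : 13 / 10 * (c.hiOf C : ℝ) + gam ≤ dist (c.zM a) (c.zM (cellIdx c.N₀ c.k₀ m)) :=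
          (pow_le_pow_iff_left₀ (by linarith) dist_nonneg two_ne_zero).1 h2
        linarith
      · -- inside the shell
        have hle : (c.nN m (cellμ c.N₀ c.k₀ a) (finProdFinEquiv.symm a).2 : ℚ) ≤ (13 / 10 * c.loOf C - gam) ^ 2 * (c.DEN : ℚ) ^ 2 := by
          unfold thrIn at hin
          exact (Int.cast_le.2 hin).trans (Int.floor_le _)
        have hleR : (c.nN m (cellμ c.N₀ c.k₀ a) (finProdFinEquiv.symm a).2 : ℝ) ≤ ((13 : ℝ) / 10 * (c.loOf C : ℝ) - (gam : ℝ)) ^ 2 * (c.DEN : ℝ) ^ 2 := by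
          have h := (Rat.cast_le (K := ℝ)).2 hle; push_cast at h; exact h
        have hthrR : (0 : ℝ) ≤ 13 / 10 * (c.loOf C : ℝ) - (gam : ℝ) := by
          have h := (Rat.cast_le (K := ℝ)).2 hthr; push_cast at h; exact h
        have hdist : dist (c.zM a) (c.zM (cellIdx c.N₀ c.k₀ m)) ^ 2 = (c.nN m (cellμ c.N₀ c.k₀ a) (finProdFinEquiv.symm a).2 : ℝ) / (c.DEN : ℝ) ^ 2 := by
          rw [c.dist_zM hD, mul_pow, inv_pow, Real.sq_sqrt (by exact_mod_cast c.nN_nonneg _ _ _)]; field_simp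
        refine ⟨?_, hpt i, ?_⟩
        · have h2 : dist (c.zM a) (c.zM (cellIdx c.N₀ c.k₀ m)) ^ 2 ≤ ((13 : ℝ) / 10 * c.loOf C - gam) ^ 2 := by
            rw [hdist, div_le_iff₀ (pow_pos hD' 2)]; exact hleR
          have h3 := (pow_le_pow_iff_left₀ dist_nonneg hthrR two_ne_zero).1 h2
          linarith
        · show c.zM (finProdFinEquiv (C.asg (hidx (hpt i)))) = c.zM a
          rw [hidx_hpt, hi, show ((cellμ c.N₀ c.k₀ a, (finProdFinEquiv.symm a).2) : Fin c.N₀ × Fin c.K3) = finProdFinEquiv.symm a from rfl,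
            Equiv.apply_symm_apply]
  · -- ★ badness: the radial obstruction
    refine not_maybeGoodAt_of_radial (d₀ := d₀) (by norm_num) hpin hnnW ?_ ⟨qnn, fun h => hnn_ne (by rw [h]), ?_⟩
    · refine ⟨finProdFinEquiv C.far, ?_, ?_⟩
      · rw [show C.far = (C.far.1, C.far.2) from rfl, c.dist_zM_pair hD, hd₀]
        have h1 : (441 : ℝ) * C.Qn ≤ 400 * (c.nN m C.far.1 C.far.2 : ℝ) := by exact_mod_cast hfar.1
        have : (1 + 1 / 20) * Real.sqrt (C.Qn : ℝ) ≤ Real.sqrt (c.nN m C.far.1 C.far.2 : ℝ) := by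
          rw [show (1 + 1 / 20 : ℝ) = Real.sqrt ((21 / 20) ^ 2) by rw [Real.sqrt_sq (by norm_num)]; norm_num, ← Real.sqrt_mul (by positivity)]
          exact Real.sqrt_le_sqrt (by linarith)
        calc (1 + 1 / 20) * (((c.DEN : ℝ))⁻¹ * Real.sqrt (C.Qn : ℝ)) = ((c.DEN : ℝ))⁻¹ * ((1 + 1 / 20) * Real.sqrt (C.Qn : ℝ)) := by ring
          _ ≤ ((c.DEN : ℝ))⁻¹ * Real.sqrt (c.nN m C.far.1 C.far.2 : ℝ) := mul_le_mul_of_nonneg_left this (by positivity)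
      · rw [show C.far = (C.far.1, C.far.2) from rfl, c.dist_zM_pair hD, hd₀]
        have h1 : (100 : ℝ) * (c.nN m C.far.1 C.far.2 : ℝ) < 169 * C.Qn := by exact_mod_cast hfar.2
        have : Real.sqrt (c.nN m C.far.1 C.far.2 : ℝ) < 13 / 10 * Real.sqrt (C.Qn : ℝ) := by
          rw [show (13 / 10 : ℝ) = Real.sqrt ((13 / 10) ^ 2) by rw [Real.sqrt_sq (by norm_num)], ← Real.sqrt_mul (by positivity)]
          exact Real.sqrt_lt_sqrt (by exact_mod_cast c.nN_nonneg _ _ _) (by linarith)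
        calc ((c.DEN : ℝ))⁻¹ * Real.sqrt (c.nN m C.far.1 C.far.2 : ℝ) < ((c.DEN : ℝ))⁻¹ * (13 / 10 * Real.sqrt (C.Qn : ℝ)) :=
              mul_lt_mul_of_pos_left this (by positivity)
          _ = 13 / 10 * (((c.DEN : ℝ))⁻¹ * Real.sqrt (C.Qn : ℝ)) := by ring
    · rw [hdnn, hd₀, inv_mul_le_iff₀ hD']
      have : Real.sqrt (C.Qn : ℝ) ≤ Real.sqrt ((2 * c.DEN : ℝ) ^ 2) := Real.sqrt_le_sqrt (by
        have : (C.Qn : ℝ) ≤ 4 * (c.DEN : ℝ) ^ 2 := by exact_mod_cast hQ4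
        linarith)
      rw [Real.sqrt_sq (by positivity)] at this
      linarith
  · -- ★ the site sum
    have hterm : ∀ q, effPot w₄₅ ω₄ (3 / 400) (dist (c.x m) (c.zM q)) ≤
        (ubTerm c.DEN (c.nN m (cellμ c.N₀ c.k₀ q) (finProdFinEquiv.symm q).2).toNat : ℝ) := by
      intro q
      rw [dist_comm, c.dist_superMotif_centre hD m q]
      have hcast : (c.nN m (cellμ c.N₀ c.k₀ q) (finProdFinEquiv.symm q).2 : ℝ) =
          ((c.nN m (cellμ c.N₀ c.k₀ q) (finProdFinEquiv.symm q).2).toNat : ℕ) := by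
        have := Int.toNat_of_nonneg (c.nN_nonneg m (cellμ c.N₀ c.k₀ q) (finProdFinEquiv.symm q).2)
        exact_mod_cast this.symm
      rw [hcast]
      exact effPot_le_ubTerm hD _
    calc (∑ q, effPot w₄₅ ω₄ (3 / 400) (dist (c.x m) (c.zM q)))
        ≤ ∑ q, (ubTerm c.DEN (c.nN m (cellμ c.N₀ c.k₀ q) (finProdFinEquiv.symm q).2).toNat : ℝ) := Finset.sum_le_sum fun q _ => hterm q
      _ = ((∑ q, ubTerm c.DEN (c.nN m (cellμ c.N₀ c.k₀ q) (finProdFinEquiv.symm q).2).toNat : ℚ) : ℝ) := by push_cast; rfl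
      _ = ((∑ m' : Fin c.N₀, sumBelow (fun t => ubTerm c.DEN (c.nN m m' t).toNat) c.K3 : ℚ) : ℝ) := by
          congr 1
          rw [sum_cell_eq c.N₀ c.k₀ (fun m' (t : Fin ((2 * c.k₀ + 1) ^ 3)) => ubTerm c.DEN (c.nN m m' t).toNat)]
          refine Finset.sum_congr rfl fun m' _ => ?_
          rw [sumBelow_eq, ← Fin.sum_univ_eq_sum_range]
      _ ≤ (C.Ub : ℝ) := by exact_mod_cast hsum

/-! ## §4. Assembly -/

/-- ★★ **An accepted cell certificate refutes `E′♭₄₅(κ_E; C_E, D_E)` for every `C_E, D_E`** as soon as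
`Σ_m ((Ub_m + 3/200)/2 − 3/400) < N₀·(eUp + κ_E)`. [folklore] -/
theorem not_schurElasticPricing_fourHalf_of_check (cert : Fin c.N₀ → ClassCert c.N₀ c.K3) (hG : c.checkGeom = true)
    (hC : ∀ m, c.checkClass m (cert m) = true) {eUp κE : ℝ}
    (hκ : ((∑ m, (((cert m).Ub + 3 / 200) / 2 - 3 / 400) : ℚ) : ℝ) < c.N₀ * (eUp + κE)) (CE DE : ℝ) :
    ¬ SchurElasticPricing (1 / 20) (1 / 8) w₄₅ ω₄ (3 / 400) eUp κE CE DE := by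
  obtain ⟨hD, hN, hsep, hdual, hb, hdiam, hk⟩ := c.geom_sound hG
  have hN' : (0 : ℝ) < c.N₀ := by exact_mod_cast hN
  set T : ℝ := ((∑ m, (((cert m).Ub + 3 / 200) / 2 - 3 / 400) : ℚ) : ℝ) with hT
  set δ : ℝ := (c.N₀ * (eUp + κE) - T) / c.N₀ with hδ
  have hδpos : 0 < δ := div_pos (by linarith) hN'
  have hW0 : effPot w₄₅ ω₄ (3 / 400) 0 = -(3 / 200) := effPot_fourHalf_zero
  refine not_schurElasticPricing_of_cell (ϱ := 9 / 2) hN hsep hdual hb hdiam hk (cellμσ_injective c.N₀ c.k₀) (abs_cellσ_le c.N₀ c.k₀)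
    (cell_sup c.N₀ c.k₀) (cellIdx_spec c.N₀ c.k₀) (R := 9 / 2) (Wsup := 7) (by norm_num) (fun r hr => effPot_fourHalf_eq_zero _ hr) le_rfl
    (fun r hr => effPot_fourHalf_le hr) (by norm_num) (D := 2) (by norm_num) (by norm_num)
    (fun m => (c.class_sound hD m (cert m) (hC m)).1) (fun m => (c.class_sound hD m (cert m) (hC m)).2.1) hδpos ?_ CE DE
  -- the deficit
  have hcls : ∀ m, ((∑ q, effPot w₄₅ ω₄ (3 / 400) (dist (c.x m) (c.zM q))) - effPot w₄₅ ω₄ (3 / 400) 0) / 2 - 3 / 400 ≤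
      ((((cert m).Ub + 3 / 200) / 2 - 3 / 400 : ℚ) : ℝ) := by
    intro m
    have := (c.class_sound hD m (cert m) (hC m)).2.2
    rw [hW0]; push_cast; linarith
  calc (∑ m, (((∑ q, effPot w₄₅ ω₄ (3 / 400) (dist (c.x m) (c.zM q))) - effPot w₄₅ ω₄ (3 / 400) 0) / 2 - 3 / 400))
      ≤ ∑ m, ((((cert m).Ub + 3 / 200) / 2 - 3 / 400 : ℚ) : ℝ) := Finset.sum_le_sum fun m _ => hcls m
    _ = T := by rw [hT]; push_cast; rfl
    _ = c.N₀ * (eUp + κE - δ) := by rw [hδ]; field_simp; ring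

end Cell

end Summit.AtomisticToContinuum.Crystallization.Theorems.FrustratedLawDichotomyCellChecker

end
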